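import Summits.QuantumFields.YangMills.Theorems.BalabanUVNodesN15KingModelFullPropagatorGradProfile
import Summits.QuantumFields.YangMills.Theorems.BalabanUVNodesN15KingModelFullPropagatorTorusWalk
import Summits.QuantumFields.YangMills.Theorems.BalabanUVNodesN15KingModelFullPropagatorPowerLaw

/-!
# BalabanUVNodes ∕ N15 — THE KING-MODEL RUNG, CURVED EDITION (PART T-b): THE HÖLDER ∕ LIPSCHITZ CLAUSE FOR THE FULL `A = 0` FLUCTUATION
# PROPAGATOR — `|G^η_K(x′, z) − G^η_K(x, z)| ≤ C·(|x − x′|∕|x − z|)·|x − z|^{2−(d+1)}` for `|x − x′| ≤ ½|x − z|`: King's (3.65) ∕ Theorem 3.3 (3.8)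
# Hölder clause (even at `α = 1`) for the FULL propagator, from part R-c's gradient power law along a COORDINATE PATH on the torus
# (Track A, DAG node N15 = NE2; FAN-OUT v1.1 §N15 s3 «KING-MODEL RUNG … + the one-line statement of what the curved case adds»)

HONEST FRAMING.  Count-neutral kernel bookkeeping (cell `pub-ymgap`, seat `pub-ymgap-dag-n15-e` g8; `--supports stmt-QuantumFields-20296
--as helper` = K3⁵ `SpineGivenEndpointR13SepCoP`, WORDS-141).  TEMPLATE LITERATURE, `A = 0`: C. King's scalar U(1)-Higgs MODEL on finite tori ([King1986]
§2.2 p. 653 (2.13)–(2.17), Theorem 3.3 pp. 655–656 ((3.8) p. 656, the Hölder clause «see [Ba 4]»), (3.62) p. 663 (the Hölder derivative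
`(∂_α(x, y)G)(z) = |x − y|^{−α}{G(x, z) − G(y, z)}`), Prop. 3.7 (3.65) p. 663 «`|∂_α(x, y)G^η_{(j)}(z)| ≤ C(L^jη)^{2−d−α}exp[−δ₀(L^jη)^{−1}dist({x, y}, z)]`»,
King's `d` = this file's `d + 1`), NOT Bałaban's covariant objects; the statement below is the (2.17)-SUMMED SHAPE of the first Hölder clause of
(3.65) for King's (2.13) at `A = 0`, NOT a printed proposition; NE2⁺ is NOT PRINTED and not proved here; NOT a node discharge; nothing continuum ∕
ℝ⁴ ∕ OS ∕ mass-gap ∕ Clay.  0 `sorry`, 0 `def`, standard axioms.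

THE POINT.  Part R-c (`fullPropD_powerLaw_unif`) bounds ONE lattice step of King's full `A = 0` propagator in the observation point:
`|L^K[G(x + e_μ, z) − G(x, z)]| ≤ C·(L^K∕|x − z|)^{d}`.  To compare `G(x′, z)` with `G(x, z)` for ARBITRARY `x, x′` one walks from `x` to `x′`; on
the torus the walk must use the SHORT arcs (the long way round passes near `z`).  THIS FILE supplies that walk and sums part R-c along it:
* the walk is part T-a (`…FullPropagatorTorusWalk`): ★ `exists_short_arc` (short arcs per coordinate), ★★ `abs_sub_le_of_ball_steps`
  (`|F(x′) − F(x)| ≤ dd·|x − x′|_K·B` when every lattice step inside the sup-ball of radius `|x − x′|_K` around `x` costs `≤ B`);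
* ★★ **`fullProp_lipschitz_unif`** (`d ≥ 1`): `∃ C > 0 ∀ K ≥ 1 ∀ N = L^K ∀ cube 2L^e ∀ 0 < m² ≤ m₀² ∀ x x′ z`, `x ≠ z`, `2|x − x′| ≤ |x − z|` (fine
  sup distances `ρ = |x − x′|`, `r = |x − z|`):  `|G(K, M, m²)(x′, z) − G(K, M, m²)(x, z)| ≤ C·(ρ∕r)·((L^K)∕r)^{d−1}` — in unit coordinates
  `C·|x − x′|·|x − z|^{1−(d+1)}`, i.e. (3.62)'s Hölder quotient AT `α = 1` bounded by the (3.65) majorant `C|x − z|^{2−(d+1)−α}` summed over the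
  slices (every step of the walk sits at distance `≥ r∕2` from `z`, where part R-c gives `(2L^K∕r)^d∕L^K` per step; `(d+1)ρ` steps);
  `fullProp_lipschitz_source_unif` (the same in the SOURCE point, `constrainedProp_symm`); ★ **`fullProp_holder_unif`** (`0 < α ≤ 1`: the
  quotient form `≤ C·(ρ∕r)^α·((L^K)∕r)^{d−1}` = `C|x − x′|^α|x − z|^{2−(d+1)−α}`, since `ρ∕r ≤ ½`); ★★ **`fullProp_holder_dist_unif`** (`d ≥ 2`):
  ALL `x, x′ ≠ z`: `≤ C·(ρ∕m)^α·((L^K)∕m)^{d−1}`, `m = min(|x − z|, |x′ − z|)` = King's `dist({x, x′}, z)` — (3.65)'s first clause VERBATIM in shape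
  (near regime: the walk; far regime: part R-b's power law twice and `(2ρ∕m)^α ≥ 1`).
WHAT THE CURVED CASE ADDS (one line): Bałaban's ∕ King's (3.8) for `G_k(U)` carries the PARALLEL TRANSPORT `U(A(Γ_{y,x}))` along the contour and
`α < 1` (the covariant kernel is Hölder, not Lipschitz, uniformly in the background); at `A = 0` the transport is `1` and `α = 1` is allowed.
HONEST SCOPE.  (i) `A = 0`, periodic b.c., odd `L ≥ 3`, `0 < m² ≤ m₀²`, cubes `2L^e`; (ii) lattice units of level `K`; (iii) `K ≥ 1`, `d ≥ 1`; (iv) the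
NEAR regime `2|x − x′| ≤ |x − z|` for the Lipschitz form (`d ≥ 1`), all configurations for the Hölder form at `dist({x, x′}, z)` (`d ≥ 2`); (v) no exponential
factor displayed (part R-d's decay multiplies through the same walk; not repeated); (vi) not Bałaban's `G_k(U)`; not a discharge.
Locators: [King1986] C. King, CMP **102** (1986) 649–677: (2.13)–(2.17) p. 653, Theorem 3.3 p. 655, (3.7)–(3.8) p. 656, (3.62) p. 663, Prop. 3.7
(3.63)–(3.65) p. 663; [Ba 4] = [Balaban1983RegularityDecay] Theorem (1.10) p. 573 (Hölder clause).
-/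

noncomputable section

namespace Summit.QuantumFields.YangMills.BalabanUVNodes.N15KingModelRung.Curved

open Real Finset Matrix
open Literature.MathematicalPhysics.QuantumFieldTheory.Balaban1983to89.B5Prop11Plancherel (Tor fine unitVec)
open Literature.MathematicalPhysics.QuantumFieldTheory.King1986 (aK aK_pos)
open Literature.MathematicalPhysics.QuantumFieldTheory.King1986.Torus (constrainedProp tdistT tdistT_nonneg tdistT_triangle tdistT_symm)

/-! ## The Hölder ∕ Lipschitz clause for the full `A = 0` propagator -/

section Holder

variable {d : ℕ} (L : ℕ) [NeZero L]

/-- **THE LIPSCHITZ CLAUSE FOR KING'S FULL `A = 0` FLUCTUATION PROPAGATOR** (`d ≥ 1`; (3.62)'s Hölder quotient at `α = 1`): for odd `L ≥ 3`,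
`a > 0`, `m₀² ≥ 0` there is `C > 0` (a function of `d, L, a, m₀²`) such that for EVERY `K ≥ 1` (any spelling `N = L^K`), cube `M_μ = 2L^e`, mass
`0 < m² ≤ m₀²` and all fine points `x, x′, z` with `x ≠ z` and `2|x − x′| ≤ |x − z|` (fine sup torus distances `ρ`, `r`):
`|G^η_K(x′, z) − G^η_K(x, z)| ≤ C·(ρ∕r)·((L^K)∕r)^{d−1}` — in unit coordinates `C·|x − x′|·|x − z|^{1−(d+1)}`: the (3.65) ∕ Theorem 3.3 (3.8)
Hölder majorant summed over (2.17), at `α = 1`, uniformly in `K`, the volume and the mass.  Part R-c's one-step bound `(2L^K∕r)^d∕L^K` (every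
point of the walk is at distance `≥ r∕2` from `z`) summed along §1's coordinate walk of `≤ (d+1)ρ` steps.
[cite: King1986, (2.13)–(2.17) p.653, Theorem 3.3 (3.8) p.656, (3.62) p.663, Prop. 3.7 (3.65) p.663; Balaban1983RegularityDecay, Theorem (1.10) p.573] -/
theorem fullProp_lipschitz_unif (hd : 1 ≤ d) (hLodd : Odd L) (hL : 2 ≤ L) {a : ℝ} (ha : 0 < a) {m0sq : ℝ} (hm0 : 0 ≤ m0sq) :
    ∃ C : ℝ, 0 < C ∧ ∀ (K : ℕ), 1 ≤ K → ∀ (N : ℕ) [NeZero N], N = L ^ K →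
      ∀ (e : ℕ) (M : Fin (d + 1) → ℕ) [∀ μ, NeZero (M μ)], (∀ μ, M μ = 2 * L ^ e) →
      ∀ (msq : ℝ), 0 < msq → msq ≤ m0sq → ∀ x x' z : Tor (fine N M), x ≠ z →
        2 * tdistT (fine N M) x x' ≤ tdistT (fine N M) x z →
        |constrainedProp N M (aK a L K) (((N : ℕ) : ℝ) ^ 2) msq x' z - constrainedProp N M (aK a L K) (((N : ℕ) : ℝ) ^ 2) msq x z|
          ≤ C * (tdistT (fine N M) x x' / tdistT (fine N M) x z) * (((L : ℝ) ^ K) / tdistT (fine N M) x z) ^ (d - 1) := by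
  have hL0 : (0 : ℝ) < L := by exact_mod_cast (show 0 < L by omega)
  obtain ⟨C₁, hC₁, H₁⟩ := fullPropD_powerLaw_unif (d := d) L hd hLodd hL ha hm0
  refine ⟨((d + 1 : ℕ) : ℝ) * C₁ * 2 ^ d, by positivity, ?_⟩
  intro K hK N _ hN e M _ hM msq hmsq hcap x x' z hxz hnear
  set ρ : ℝ := tdistT (fine N M) x x' with hρdef
  set r : ℝ := tdistT (fine N M) x z with hrdef
  have hρ0 : 0 ≤ ρ := tdistT_nonneg _ x x'
  have hr1 : 1 ≤ r := one_le_tdistT_of_ne (fine N M) hxz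
  have hr0 : 0 < r := by linarith
  have hNc : (N : ℝ) = (L : ℝ) ^ K := by rw [hN]; push_cast; ring
  have hN0 : (0 : ℝ) < N := by rw [hNc]; positivity
  -- the step bound inside the ball: part R-c at distance `≥ r∕2`
  set B : ℝ := C₁ * (2 * (L : ℝ) ^ K / r) ^ d / N with hBdef
  have hB0 : 0 ≤ B := by positivity
  have hstep : ∀ w : Tor (fine N M), tdistT (fine N M) x w ≤ ρ → ∀ μ : Fin (d + 1),
      tdistT (fine N M) x (w + unitVec (fine N M) μ) ≤ ρ →
      |constrainedProp N M (aK a L K) (((N : ℕ) : ℝ) ^ 2) msq (w + unitVec (fine N M) μ) z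
          - constrainedProp N M (aK a L K) (((N : ℕ) : ℝ) ^ 2) msq w z| ≤ B := by
    intro w hw μ _
    set rw : ℝ := tdistT (fine N M) w z with hrwdef
    have htri : r ≤ ρ + rw := by
      calc r ≤ tdistT (fine N M) x w + rw := tdistT_triangle _ x w z
        _ ≤ ρ + rw := by linarith
    have hrw : r / 2 ≤ rw := by linarith
    have hrw0 : 0 < rw := by linarith
    have hwz : w ≠ z := by
      intro h
      rw [hrwdef, h, Literature.MathematicalPhysics.QuantumFieldTheory.King1986.Torus.tdistT_self] at hrw0
      exact lt_irrefl _ hrw0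
    have h1 := H₁ K hK N hN e M hM msq hmsq hcap μ w z hwz
    -- `(L^K∕rw)^d ≤ (2L^K∕r)^d`
    have hratio : (L : ℝ) ^ K / rw ≤ 2 * (L : ℝ) ^ K / r := by
      rw [div_le_div_iff₀ hrw0 hr0]
      nlinarith [pow_pos hL0 K]
    have hpow : ((L : ℝ) ^ K / rw) ^ d ≤ (2 * (L : ℝ) ^ K / r) ^ d := pow_le_pow_left₀ (by positivity) hratio d
    have h2 : |(N : ℝ) * (constrainedProp N M (aK a L K) (((N : ℕ) : ℝ) ^ 2) msq (w + unitVec (fine N M) μ) z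
          - constrainedProp N M (aK a L K) (((N : ℕ) : ℝ) ^ 2) msq w z)| ≤ C₁ * (2 * (L : ℝ) ^ K / r) ^ d :=
      h1.trans (mul_le_mul_of_nonneg_left hpow hC₁.le)
    rw [abs_mul, abs_of_pos hN0] at h2
    rw [hBdef, le_div_iff₀ hN0, mul_comm]
    exact h2
  -- the coordinate walk
  have hwalk := abs_sub_le_of_ball_steps (fine N M)
    (fun w => constrainedProp N M (aK a L K) (((N : ℕ) : ℝ) ^ 2) msq w z) x x' hB0 hstep
  -- bookkeeping: `(d+1)·ρ·B = (d+1)C₁2^d·(ρ∕r)·(L^K∕r)^{d−1}`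
  have hid : ((d + 1 : ℕ) : ℝ) * ρ * B
      = ((d + 1 : ℕ) : ℝ) * C₁ * 2 ^ d * (ρ / r) * (((L : ℝ) ^ K) / r) ^ (d - 1) := by
    rw [hBdef, hNc]
    obtain ⟨d', rfl⟩ : ∃ d', d = d' + 1 := ⟨d - 1, by omega⟩
    rw [Nat.add_sub_cancel]
    have hr' : r ≠ 0 := hr0.ne'
    have hLK : (L : ℝ) ^ K ≠ 0 := by positivity
    rw [div_pow, div_pow, mul_pow, pow_succ, pow_succ, pow_succ]
    field_simp
  calc |constrainedProp N M (aK a L K) (((N : ℕ) : ℝ) ^ 2) msq x' z - constrainedProp N M (aK a L K) (((N : ℕ) : ℝ) ^ 2) msq x z|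
      ≤ ((d + 1 : ℕ) : ℝ) * ρ * B := hwalk
    _ = ((d + 1 : ℕ) : ℝ) * C₁ * 2 ^ d * (ρ / r) * (((L : ℝ) ^ K) / r) ^ (d - 1) := hid

/-- **The Lipschitz clause in the SOURCE point** (`d ≥ 1`): `|G^η_K(z, x′) − G^η_K(z, x)| ≤ C·(ρ∕r)·((L^K)∕r)^{d−1}` under the same hypotheses —
`G^η_K` is symmetric (part Q4a `constrainedProp_symm`). [cite: King1986, (2.13) p.653, Theorem 3.3 (3.8) p.656, (3.62) p.663] -/
theorem fullProp_lipschitz_source_unif (hd : 1 ≤ d) (hLodd : Odd L) (hL : 2 ≤ L) {a : ℝ} (ha : 0 < a) {m0sq : ℝ} (hm0 : 0 ≤ m0sq) :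
    ∃ C : ℝ, 0 < C ∧ ∀ (K : ℕ), 1 ≤ K → ∀ (N : ℕ) [NeZero N], N = L ^ K →
      ∀ (e : ℕ) (M : Fin (d + 1) → ℕ) [∀ μ, NeZero (M μ)], (∀ μ, M μ = 2 * L ^ e) →
      ∀ (msq : ℝ), 0 < msq → msq ≤ m0sq → ∀ x x' z : Tor (fine N M), x ≠ z →
        2 * tdistT (fine N M) x x' ≤ tdistT (fine N M) x z →
        |constrainedProp N M (aK a L K) (((N : ℕ) : ℝ) ^ 2) msq z x' - constrainedProp N M (aK a L K) (((N : ℕ) : ℝ) ^ 2) msq z x|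
          ≤ C * (tdistT (fine N M) x x' / tdistT (fine N M) x z) * (((L : ℝ) ^ K) / tdistT (fine N M) x z) ^ (d - 1) := by
  obtain ⟨C, hC, H⟩ := fullProp_lipschitz_unif (d := d) L hd hLodd hL ha hm0
  refine ⟨C, hC, ?_⟩
  intro K hK N _ hN e M _ hM msq hmsq hcap x x' z hxz hnear
  rw [constrainedProp_symm N M _ _ _ z x', constrainedProp_symm N M _ _ _ z x]
  exact H K hK N hN e M hM msq hmsq hcap x x' z hxz hnear

/-- **THE HÖLDER CLAUSE** (`d ≥ 1`, `0 < α ≤ 1`): under the same hypotheses, `|G^η_K(x′, z) − G^η_K(x, z)| ≤ C·(ρ∕r)^α·((L^K)∕r)^{d−1}` — in unit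
coordinates `C·|x − x′|^α·|x − z|^{2−(d+1)−α}`, the printed exponent of (3.65)'s first clause (`ρ∕r ≤ ½ ≤ 1`, so `ρ∕r ≤ (ρ∕r)^α`).
[cite: King1986, Theorem 3.3 (3.8) p.656, (3.62) p.663, Prop. 3.7 (3.65) p.663] -/
theorem fullProp_holder_unif (hd : 1 ≤ d) (hLodd : Odd L) (hL : 2 ≤ L) {a : ℝ} (ha : 0 < a) {m0sq : ℝ} (hm0 : 0 ≤ m0sq)
    {α : ℝ} (hα0 : 0 < α) (hα1 : α ≤ 1) :
    ∃ C : ℝ, 0 < C ∧ ∀ (K : ℕ), 1 ≤ K → ∀ (N : ℕ) [NeZero N], N = L ^ K →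
      ∀ (e : ℕ) (M : Fin (d + 1) → ℕ) [∀ μ, NeZero (M μ)], (∀ μ, M μ = 2 * L ^ e) →
      ∀ (msq : ℝ), 0 < msq → msq ≤ m0sq → ∀ x x' z : Tor (fine N M), x ≠ z →
        2 * tdistT (fine N M) x x' ≤ tdistT (fine N M) x z →
        |constrainedProp N M (aK a L K) (((N : ℕ) : ℝ) ^ 2) msq x' z - constrainedProp N M (aK a L K) (((N : ℕ) : ℝ) ^ 2) msq x z|
          ≤ C * (tdistT (fine N M) x x' / tdistT (fine N M) x z) ^ α * (((L : ℝ) ^ K) / tdistT (fine N M) x z) ^ (d - 1) := by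
  obtain ⟨C, hC, H⟩ := fullProp_lipschitz_unif (d := d) L hd hLodd hL ha hm0
  refine ⟨C, hC, ?_⟩
  intro K hK N _ hN e M _ hM msq hmsq hcap x x' z hxz hnear
  have h := H K hK N hN e M hM msq hmsq hcap x x' z hxz hnear
  set q : ℝ := tdistT (fine N M) x x' / tdistT (fine N M) x z with hqdef
  have hr1 : 1 ≤ tdistT (fine N M) x z := one_le_tdistT_of_ne (fine N M) hxz
  have hq0 : 0 ≤ q := div_nonneg (tdistT_nonneg _ x x') (by linarith)
  have hq1 : q ≤ 1 := by
    rw [hqdef, div_le_one (by linarith)]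
    linarith [tdistT_nonneg (fine N M) x x']
  have hqα : q ≤ q ^ α := by
    rcases hq0.eq_or_lt with h0 | hpos
    · rw [← h0, Real.zero_rpow hα0.ne']
    · calc q = q ^ (1 : ℝ) := (Real.rpow_one q).symm
        _ ≤ q ^ α := Real.rpow_le_rpow_of_exponent_ge hpos hq1 hα1
  have hP : 0 ≤ (((L : ℝ) ^ K) / tdistT (fine N M) x z) ^ (d - 1) := by positivity
  calc _ ≤ C * q * (((L : ℝ) ^ K) / tdistT (fine N M) x z) ^ (d - 1) := h
    _ ≤ C * q ^ α * (((L : ℝ) ^ K) / tdistT (fine N M) x z) ^ (d - 1) :=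
        mul_le_mul_of_nonneg_right (mul_le_mul_of_nonneg_left hqα hC.le) hP

/-- **KING'S (3.65), FIRST CLAUSE, FOR THE FULL `A = 0` PROPAGATOR — ALL CONFIGURATIONS** (`d ≥ 2`, `0 < α ≤ 1`): for odd `L ≥ 3`, `a > 0`,
`m₀² ≥ 0` there is `C > 0` such that for EVERY `K ≥ 1`, cube, mass and all fine `x, x′, z` with `x ≠ z`, `x′ ≠ z`, writing `ρ = |x − x′|` and
`m = min(|x − z|, |x′ − z|)` (King's `dist({x, x′}, z)`):
`|G^η_K(x′, z) − G^η_K(x, z)| ≤ C·(ρ∕m)^α·((L^K)∕m)^{d−1}` = `C·|x − x′|^α·dist({x, x′}, z)^{2−(d+1)−α}` in unit coordinates — the (3.62) Hölder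
quotient bounded by the (3.65) majorant at the distance `dist({x, x′}, z)`, summed over (2.17), uniformly in `K`, the volume and the mass.  NEAR
regime `2ρ ≤ |x − z|`: `fullProp_holder_unif` (and `m ≤ |x − z|`); FAR regime: the triangle inequality with part R-b `fullProp_powerLaw_unif` at
the two distances and `(2ρ∕m)^α ≥ 1`. [cite: King1986, Theorem 3.3 (3.8) p.656, (3.62) p.663, Prop. 3.7 (3.65) p.663] -/
theorem fullProp_holder_dist_unif (hd : 2 ≤ d) (hLodd : Odd L) (hL : 2 ≤ L) {a : ℝ} (ha : 0 < a) {m0sq : ℝ} (hm0 : 0 ≤ m0sq)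
    {α : ℝ} (hα0 : 0 < α) (hα1 : α ≤ 1) :
    ∃ C : ℝ, 0 < C ∧ ∀ (K : ℕ), 1 ≤ K → ∀ (N : ℕ) [NeZero N], N = L ^ K →
      ∀ (e : ℕ) (M : Fin (d + 1) → ℕ) [∀ μ, NeZero (M μ)], (∀ μ, M μ = 2 * L ^ e) →
      ∀ (msq : ℝ), 0 < msq → msq ≤ m0sq → ∀ x x' z : Tor (fine N M), x ≠ z → x' ≠ z →
        |constrainedProp N M (aK a L K) (((N : ℕ) : ℝ) ^ 2) msq x' z - constrainedProp N M (aK a L K) (((N : ℕ) : ℝ) ^ 2) msq x z|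
          ≤ C * (tdistT (fine N M) x x' / min (tdistT (fine N M) x z) (tdistT (fine N M) x' z)) ^ α
              * (((L : ℝ) ^ K) / min (tdistT (fine N M) x z) (tdistT (fine N M) x' z)) ^ (d - 1) := by
  have hL0 : (0 : ℝ) < L := by exact_mod_cast (show 0 < L by omega)
  obtain ⟨C₁, hC₁, H₁⟩ := fullProp_holder_unif (d := d) L (by omega) hLodd hL ha hm0 hα0 hα1
  obtain ⟨C₂, hC₂, H₂⟩ := fullProp_powerLaw_unif (d := d) L hd hLodd hL ha hm0
  refine ⟨max C₁ (2 * C₂ * (2 : ℝ) ^ α), lt_max_of_lt_left hC₁, ?_⟩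
  intro K hK N _ hN e M _ hM msq hmsq hcap x x' z hxz hx'z
  set ρ : ℝ := tdistT (fine N M) x x' with hρdef
  set r : ℝ := tdistT (fine N M) x z with hrdef
  set r' : ℝ := tdistT (fine N M) x' z with hr'def
  set m : ℝ := min r r' with hmdef
  have hρ0 : 0 ≤ ρ := tdistT_nonneg _ x x'
  have hr1 : 1 ≤ r := one_le_tdistT_of_ne (fine N M) hxz
  have hr'1 : 1 ≤ r' := one_le_tdistT_of_ne (fine N M) hx'z
  have hm1 : 1 ≤ m := le_min hr1 hr'1
  have hm0 : 0 < m := by linarith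
  have hmr : m ≤ r := min_le_left _ _
  have hmr' : m ≤ r' := min_le_right _ _
  have hLK : 0 < (L : ℝ) ^ K := pow_pos hL0 K
  have hPm : 0 ≤ (((L : ℝ) ^ K) / m) ^ (d - 1) := by positivity
  have hQm : 0 ≤ (ρ / m) ^ α := Real.rpow_nonneg (by positivity) α
  -- `(L^K∕r)^{d−1} ≤ (L^K∕m)^{d−1}` and the same for `r′`
  have hpow : ∀ {s : ℝ}, m ≤ s → 0 < s → (((L : ℝ) ^ K) / s) ^ (d - 1) ≤ (((L : ℝ) ^ K) / m) ^ (d - 1) := fun hms hs =>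
    pow_le_pow_left₀ (by positivity) (div_le_div_of_nonneg_left hLK.le hm0 hms) _
  rcases le_or_gt (2 * ρ) r with hnear | hfar
  · -- near regime
    have h := H₁ K hK N hN e M hM msq hmsq hcap x x' z hxz hnear
    have hq : (ρ / r) ^ α ≤ (ρ / m) ^ α :=
      Real.rpow_le_rpow (by positivity) (div_le_div_of_nonneg_left hρ0 hm0 hmr) hα0.le
    calc _ ≤ C₁ * (ρ / r) ^ α * (((L : ℝ) ^ K) / r) ^ (d - 1) := h
      _ ≤ max C₁ (2 * C₂ * (2 : ℝ) ^ α) * (ρ / m) ^ α * (((L : ℝ) ^ K) / m) ^ (d - 1) :=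
          mul_le_mul (mul_le_mul (le_max_left _ _) hq (Real.rpow_nonneg (by positivity) α) (by positivity))
            (hpow hmr (by linarith)) (by positivity) (by positivity)
  · -- far regime: two power laws and `(2ρ∕m)^α ≥ 1`
    have h1 := H₂ K hK N hN e M hM msq hmsq hcap x' z hx'z
    have h2 := H₂ K hK N hN e M hM msq hmsq hcap x z hxz
    have hbig : 1 ≤ (2 * ρ / m) ^ α := Real.one_le_rpow (by rw [le_div_iff₀ hm0]; linarith) hα0.le
    have hsplit : (2 * ρ / m) ^ α = (2 : ℝ) ^ α * (ρ / m) ^ α := by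
      rw [mul_div_assoc, Real.mul_rpow (by norm_num) (by positivity)]
    calc |constrainedProp N M (aK a L K) (((N : ℕ) : ℝ) ^ 2) msq x' z - constrainedProp N M (aK a L K) (((N : ℕ) : ℝ) ^ 2) msq x z|
        ≤ |constrainedProp N M (aK a L K) (((N : ℕ) : ℝ) ^ 2) msq x' z| + |constrainedProp N M (aK a L K) (((N : ℕ) : ℝ) ^ 2) msq x z| :=
          abs_sub _ _
      _ ≤ C₂ * (((L : ℝ) ^ K) / r') ^ (d - 1) + C₂ * (((L : ℝ) ^ K) / r) ^ (d - 1) := add_le_add h1 h2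
      _ ≤ C₂ * (((L : ℝ) ^ K) / m) ^ (d - 1) + C₂ * (((L : ℝ) ^ K) / m) ^ (d - 1) :=
          add_le_add (mul_le_mul_of_nonneg_left (hpow hmr' (by linarith)) hC₂.le)
            (mul_le_mul_of_nonneg_left (hpow hmr (by linarith)) hC₂.le)
      _ = 2 * C₂ * (((L : ℝ) ^ K) / m) ^ (d - 1) * 1 := by ring
      _ ≤ 2 * C₂ * (((L : ℝ) ^ K) / m) ^ (d - 1) * (2 * ρ / m) ^ α := mul_le_mul_of_nonneg_left hbig (by positivity)
      _ = 2 * C₂ * (2 : ℝ) ^ α * (ρ / m) ^ α * (((L : ℝ) ^ K) / m) ^ (d - 1) := by rw [hsplit]; ring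
      _ ≤ max C₁ (2 * C₂ * (2 : ℝ) ^ α) * (ρ / m) ^ α * (((L : ℝ) ^ K) / m) ^ (d - 1) :=
          mul_le_mul_of_nonneg_right (mul_le_mul_of_nonneg_right (le_max_right _ _) hQm) hPm

end Holder

end Summit.QuantumFields.YangMills.BalabanUVNodes.N15KingModelRung.Curved
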